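import Summits.BirchSwinnertonDyer.BirchSwinnertonDyer.Theorems.ErratumRoadFiveNonSurjCornerSerreLevelExact
import Literature.NumberTheory.EllipticCurves.ArtinExponentThreeTorsionOfTamagawaProofs
import Literature.NumberTheory.EllipticCurves.TamagawaRingEquivProofs
import HarnessLib

/-!
# Route `SignedLowerHalves` (K3), crux 3 `KobayashiLowerHalfLargeImage` (item stmt-BirchSwinnertonDyer-19001), line `shadow_seed`:
# THE SERRE LEVEL OF `ρ̄_{E,3}` HAS EXPONENT EXACTLY ONE AT A SHADOW PRIME
# (cell `bsd-ssimc`, width seat `bsd-line-slh-p1-w5` g2; `--supports stmt-BirchSwinnertonDyer-19001`)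

WHAT. Line `shadow_seed` (crux-ideate k1 g18; `Cruxes/KobayashiLowerHalfLargeImage/Lines/shadow_seed.lean`) runs, at
`p = 3`, through the level-LOWERED newform `g` of `ρ̄ = ρ̄_{E,3}` (Ribet–Diamond, `diamond1995_refinedSerre`: weight `2`, level
`M ∣ N(ρ̄) = serreLevel 3 ρ̄`), and needs `q ∥ M` at the shadow prime `q` (an additive prime of `E` of Kodaira type `IV`/`IV*`
with non-split mod-`3` shadow) — i.e. that the SERRE LEVEL has `q`-exponent exactly `1` although `q² ∣ N_E`. This file proves
that exponent for the census branch `c_q = 3` of the shadow predicate (all 26 off-locus `Surj`-window pairs of the card):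

* §1 `factorization_serreLevel_baseChange_three_eq_one_of_dvd_localTamagawaNumber` — for `E/ℚ`, a framed model `ρ̄` of `E[3]`,
  `j : 𝔽₃ → k`, and a prime `q ∉ {2, 3}` of ADDITIVE reduction with `3 ∣ c_q`: **`ord_q N(ρ̄ ⊗ k) = 1`**, unconditionally
  (`Literature…artinConductorExponent_baseChange_three_eq_one_of_dvd_localTamagawaNumber_of_ringChar_ne` + the corner5
  bookkeeping `NonSurjCornerSerreLevelExact.factorization_serreLevel_eq`).
* §2 `factorization_serreLevel_baseChange_three_add_one_eq_of_dvd_localTamagawaNumber` — at ANY additive `q ≠ 3` with `3 ∣ c_q`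
  (so also `q = 2`): **`ord_q N(ρ̄ ⊗ k) + 1 = ord_q N_E`**, granted Ogg–Saito for `(E, 3)` BY NAME
  (`artinConductorExponent_tate_eq_conductorExponent_of_isElliptic W 3`, whose content beyond *ATAEC* IV.10.2 is Ogg's formula at
  `q = 2`); so `ord_2 N(ρ̄ ⊗ k) = 1` at a shadow prime `q = 2` (`f_2 = 2`: `v_2(Δ_min) ∈ {4, 8}` at type `IV`/`IV*`).

WHY. The local lemma of the line «`IsShadowPrimeAt W q` ⇒ Fouquet–Wan (H3) at `ℓ = q`» was put in the kernel by w2 g7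
(`InertiaFixedTorsion…`, `GeomTorsion…Proofs`: `E[3]|Γ_{ℚ_q} ≅ (𝟙 ∗; 0 ψ)`, ramified, `ψ` unramified); the remaining typing
residue named there (`Lines/shadow-seed-L0-w2g7.md` §5) includes «Serre conductor exponent `1` at a shadow prime» — this file —
besides the forms-level FW21 Thm 5.1 (PRE), Fouquet 2025 Thm 4.1 for a newform seed, and Carayol's trivial character at `ℓ = 3`.
HONEST FRAMING: §1 unconditional, §2 conditional on Ogg–Saito BY NAME; no `sorry`, no new definition, no new named fact; the crux,
the line's stubs and BSD are NOT proved by any of this; no summit statement is touched.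
[cite: Serre1987, §1.2, §4.6 (4.6.3)] [cite: Kraus1997, p. 1143] [cite: Diamond1995RefinedSerre, Thm. 1.1]
[cite: SilvermanATAEC1994, Thm. IV.10.2, IV.11.1]
-/

set_option autoImplicit false
set_option linter.dupNamespace false

noncomputable section

open scoped Classical MatrixGroups ModularForm NumberField

open WeierstrassCurve Literature.NumberTheory Literature.NumberTheory.GaloisRepresentations
  Literature.NumberTheory.EllipticCurves Literature.NumberTheory.EllipticCurves.ModularForms
  Rat.HeightOneSpectrum IsDedekindDomain IsDedekindDomain.HeightOneSpectrum
  Literature.NumberTheory.Automorphic Literature.NumberTheory.Automorphic.BCDT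
  Literature.NumberTheory.DiophantineGeometry
  Literature.NumberTheory.GaloisRepresentations.ModPGaloisRep
  Literature.NumberTheory.GaloisRepresentations.IsNonarchimedeanLocalField
  ValuativeRel CongruenceSubgroup
  Summit.BirchSwinnertonDyer.BirchSwinnertonDyer.Theorems.NonSurjCornerSerreLevelExact

namespace Summit.BirchSwinnertonDyer.BirchSwinnertonDyer.Theorems.ShadowSeedSerreLevel

/-! ### §1 `ord_q N(ρ̄_{E,3} ⊗ k) = 1` at an additive `q ∉ {2, 3}` with `3 ∣ c_q` — unconditional -/

/-- **`ord_q N(E[3] ⊗ k) = 1` at a prime `q ∉ {2, 3}` of ADDITIVE reduction with `3 ∣ c_q`** (a shadow prime `q ≥ 5` with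
`c_q = 3`: `q ∥ N(ρ̄_{E,3})`, the Ribet–Diamond level input of line `shadow_seed`). For `E/ℚ` elliptic, a framed model `ρ̄` of
`E[3]`, `j : 𝔽₃ → k`: the exponent of `q` in `serreLevel 3 (ρ̄ ⊗ k)` is the Artin exponent `a_q(E[3] ⊗ k)`
(`factorization_serreLevel_eq`), which is `1` — tame part `codim E[3]^{I_q} = 1` (`E[3]^{I_q}` is exactly a line when `3 ∣ c_q`),
Swan part `0` at `q ∤ 6` (`artinConductorExponent_baseChange_three_eq_one_of_dvd_localTamagawaNumber_of_ringChar_ne`; currency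
bridge `localTamagawaNumber_padic_eq_holds`). Unconditional. [cite: Serre1987, §1.2, §4.6 (4.6.3)] [cite: Kraus1997, p. 1143]
[cite: SilvermanATAEC1994, Thm. IV.10.2(a)–(b)] -/
theorem factorization_serreLevel_baseChange_three_eq_one_of_dvd_localTamagawaNumber (W : WeierstrassCurve ℚ) [W.IsElliptic]
    {ρ : ModPGaloisRep ℚ (ZMod 3) 2} (hρ : W.IsTorsionGaloisRep 3 ρ)
    {k : Type*} [Field k] [TopologicalSpace k] [IsTopologicalRing k] (j : ZMod 3 →+* k) (hj : Continuous j)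
    (q : ℕ) [Fact q.Prime] (hq2 : q ≠ 2) (hq3 : q ≠ 3)
    (hng : ¬ W.HasGoodReductionAtPrime q) (hnm : ¬ W.HasMultiplicativeReductionAtPrime q)
    (hdvd : 3 ∣ (W.baseChange ℚ_[q]).localTamagawaNumber ℤ_[q]) :
    (serreLevel 3 (FramedRep.baseChange j hj ρ)).factorization q = 1 := by
  classical
  have hq : q.Prime := Fact.out
  set v : HeightOneSpectrum (𝓞 ℚ) := (primesEquiv (R := 𝓞 ℚ)).symm ⟨q, hq⟩ with hvdef
  have hv : (primesEquiv v : Nat.Primes) = ⟨q, hq⟩ := Equiv.apply_symm_apply _ _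
  have hvq : ((primesEquiv v : Nat.Primes) : ℕ) = q := by rw [hv]
  have hadd : W.HasAdditiveReductionAt v := hasAdditiveReductionAt_ringOfIntegers_of_additive W q hng hnm
  have h3v : (3 : 𝓞 ℚ) ∉ v.asIdeal := fun hmem ↦
    hq3 (hvq.symm.trans ((natCast_mem_asIdeal_iff_primesEquiv_eq v Nat.prime_three).mp
      (by exact_mod_cast hmem)))
  have h2 : ringChar (𝓞 ℚ ⧸ v.asIdeal) ≠ 2 := by
    intro h2
    have h0 : ((2 : ℕ) : 𝓞 ℚ ⧸ v.asIdeal) = 0 := (ringChar.spec _ 2).mpr (h2 ▸ dvd_rfl)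
    rw [← map_natCast (Ideal.Quotient.mk v.asIdeal), Ideal.Quotient.eq_zero_iff_mem] at h0
    exact hq2 (hvq.symm.trans ((natCast_mem_asIdeal_iff_primesEquiv_eq v Nat.prime_two).mp h0))
  have hdvd' : 3 ∣ (W.baseChange (v.adicCompletion ℚ)).localTamagawaNumber (v.adicCompletionIntegers ℚ) := by
    rwa [← localTamagawaNumber_padic_eq_holds W v q hvq]
  rw [← hvq, factorization_serreLevel_eq 3 _ (mulSupport_serreLevel_baseChange_finite W 3 hρ j hj) v
    (hvq.symm ▸ hq3)]
  exact artinConductorExponent_baseChange_three_eq_one_of_dvd_localTamagawaNumber_of_ringChar_ne hρ j hj h3v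
    h2 hadd hdvd'

/-! ### §2 `ord_q N(ρ̄_{E,3} ⊗ k) + 1 = ord_q N_E` at an additive `q ≠ 3` with `3 ∣ c_q` — granted Ogg–Saito -/

/-- **`ord_q N(E[3] ⊗ k) + 1 = ord_q N_E` at a prime `q ≠ 3` of ADDITIVE reduction with `3 ∣ c_q`, granted Ogg–Saito for
`(E, 3)` BY NAME** (`a_v(V_3 E) = f_v(E)`; only its `q = 2` clause says more than §1): the exponent of `q` in
`serreLevel 3 (ρ̄ ⊗ k)` is `a_q(E[3] ⊗ k) = a_q(V_3 E) − 1 = f_q(E) − 1`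
(`artinConductorExponent_baseChange_three_add_one_eq_conductorExponent_of_dvd_localTamagawaNumber`, `factorization_serreLevel_eq`,
the tree's bridges `conductorExponent_ringOfIntegers_eq`, `factorization_conductorNorm_primesEquiv_symm`). At a shadow prime `q = 2`
(type `IV` with `v_2(Δ_min) = 4` or `IV*` with `v_2(Δ_min) = 8`, so `f_2 = 2`) this is `2 ∥ N(ρ̄_{E,3})`.
[cite: Serre1987, §1.2, §4.6 (4.6.3)] [cite: Kraus1997, p. 1143] [cite: SilvermanATAEC1994, IV.11.1 (Ogg's formula)] -/
theorem factorization_serreLevel_baseChange_three_add_one_eq_of_dvd_localTamagawaNumber (W : WeierstrassCurve ℚ)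
    [W.IsElliptic] (hOS : W.artinConductorExponent_tate_eq_conductorExponent_of_isElliptic 3)
    {ρ : ModPGaloisRep ℚ (ZMod 3) 2} (hρ : W.IsTorsionGaloisRep 3 ρ)
    {k : Type*} [Field k] [TopologicalSpace k] [IsTopologicalRing k] (j : ZMod 3 →+* k) (hj : Continuous j)
    (q : ℕ) [Fact q.Prime] (hq3 : q ≠ 3)
    (hng : ¬ W.HasGoodReductionAtPrime q) (hnm : ¬ W.HasMultiplicativeReductionAtPrime q)
    (hdvd : 3 ∣ (W.baseChange ℚ_[q]).localTamagawaNumber ℤ_[q]) :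
    (serreLevel 3 (FramedRep.baseChange j hj ρ)).factorization q + 1 = (W.conductorNorm ℤ).factorization q := by
  classical
  have hq : q.Prime := Fact.out
  set v : HeightOneSpectrum (𝓞 ℚ) := (primesEquiv (R := 𝓞 ℚ)).symm ⟨q, hq⟩ with hvdef
  have hv : (primesEquiv v : Nat.Primes) = ⟨q, hq⟩ := Equiv.apply_symm_apply _ _
  have hvq : ((primesEquiv v : Nat.Primes) : ℕ) = q := by rw [hv]
  have hadd : W.HasAdditiveReductionAt v := hasAdditiveReductionAt_ringOfIntegers_of_additive W q hng hnm
  have h3v : (3 : 𝓞 ℚ) ∉ v.asIdeal := fun hmem ↦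
    hq3 (hvq.symm.trans ((natCast_mem_asIdeal_iff_primesEquiv_eq v Nat.prime_three).mp
      (by exact_mod_cast hmem)))
  have hdvd' : 3 ∣ (W.baseChange (v.adicCompletion ℚ)).localTamagawaNumber (v.adicCompletionIntegers ℚ) := by
    rwa [← localTamagawaNumber_padic_eq_holds W v q hvq]
  rw [← hvq, factorization_serreLevel_eq 3 _ (mulSupport_serreLevel_baseChange_finite W 3 hρ j hj) v
    (hvq.symm ▸ hq3),
    artinConductorExponent_baseChange_three_add_one_eq_conductorExponent_of_dvd_localTamagawaNumber hOS hρ j hj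
      h3v hadd hdvd', conductorExponent_ringOfIntegers_eq W v, hv, factorization_conductorNorm_primesEquiv_symm W ⟨q, hq⟩]

/-! ### §3 The shadow predicate's own currency: Kodaira `IV`/`IV*` over `ℤ_[q]` with `c_q = 3` -/

/-- **At a shadow prime `q ≥ 5` with `c_q = 3`, `q ∥ N(ρ̄_{E,3})`** — the hypotheses of line `shadow_seed`'s `IsShadowPrimeAt W q`
read verbatim in its `ℤ_[q]`-currency (Kodaira symbol `IV` or `IV*` of `W ⊗ ℚ_q` over `ℤ_[q]`, local Tamagawa number `3`; the
valuation clause `v_q(Δ_min) ∈ {4, 8}` is not needed): the Kodaira symbol is of additive type (`KodairaSymbol.IsAdditive`, decided),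
so `W` has additive reduction at the place over `q` (`kodairaSymbolAt_eq_padic`, `isAdditive_kodairaSymbolAt_iff_holds`, and the
prime ↔ place bridges), and §1 applies. Unconditional; the branch `c_q = 1` (`q ≡ 1 mod 3`) of the predicate is not treated (no
census pair of the card uses it). [cite: SilvermanATAEC1994, IV.9.4 (Tate's algorithm) and Thm. IV.10.2] [cite: Serre1987, §1.2] -/
theorem factorization_serreLevel_baseChange_three_eq_one_of_kodairaSymbol_IV_or_IVstar (W : WeierstrassCurve ℚ) [W.IsElliptic]
    {ρ : ModPGaloisRep ℚ (ZMod 3) 2} (hρ : W.IsTorsionGaloisRep 3 ρ)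
    {k : Type*} [Field k] [TopologicalSpace k] [IsTopologicalRing k] (j : ZMod 3 →+* k) (hj : Continuous j)
    (q : ℕ) [Fact q.Prime] (hq2 : q ≠ 2) (hq3 : q ≠ 3)
    (hK : (W.baseChange ℚ_[q]).kodairaSymbol ℤ_[q] = KodairaSymbol.IV ∨
      (W.baseChange ℚ_[q]).kodairaSymbol ℤ_[q] = KodairaSymbol.IVstar)
    (hc : (W.baseChange ℚ_[q]).localTamagawaNumber ℤ_[q] = 3) :
    (serreLevel 3 (FramedRep.baseChange j hj ρ)).factorization q = 1 := by
  classical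
  have hq : q.Prime := Fact.out
  set v : HeightOneSpectrum (𝓞 ℚ) := (primesEquiv (R := 𝓞 ℚ)).symm ⟨q, hq⟩ with hvdef
  have hv : (primesEquiv v : Nat.Primes) = ⟨q, hq⟩ := Equiv.apply_symm_apply _ _
  -- the Kodaira symbol is of additive type, so `W` has additive reduction at `v`
  have hKadd : ((W.baseChange ℚ_[q]).kodairaSymbol ℤ_[q]).IsAdditive := by
    rcases hK with h | h <;> rw [h] <;> decide
  have hadd : W.HasAdditiveReductionAt v := by
    have key : ∀ r : Nat.Primes, primesEquiv v = r →
        (haveI := Fact.mk r.2; ((W.baseChange ℚ_[(r : ℕ)]).kodairaSymbol ℤ_[(r : ℕ)]).IsAdditive) →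
        W.HasAdditiveReductionAt v := by
      rintro r rfl h
      haveI : PerfectField (IsLocalRing.ResidueField (v.adicCompletionIntegers ℚ)) := PerfectField.ofFinite
      refine (W.isAdditive_kodairaSymbolAt_iff_holds v).mp ?_
      rw [kodairaSymbolAt_eq_padic v W]
      exact h
    exact key ⟨q, hq⟩ hv hKadd
  have hng : ¬ W.HasGoodReductionAtPrime q := by
    have key : ∀ r : Nat.Primes, primesEquiv v = r →
        (haveI := Fact.mk r.2; ¬ W.HasGoodReductionAtPrime (r : ℕ)) := by
      rintro r rfl h
      exact hadd.not_hasGoodReductionAt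
        ((hasGoodReductionAtPrime_iff_hasGoodReductionAt_ringOfIntegers (v := v) W).mp h)
    exact key ⟨q, hq⟩ hv
  have hnm : ¬ W.HasMultiplicativeReductionAtPrime q := by
    have key : ∀ r : Nat.Primes, primesEquiv v = r →
        (haveI := Fact.mk r.2; ¬ W.HasMultiplicativeReductionAtPrime (r : ℕ)) := by
      rintro r rfl h
      exact hadd.not_hasMultiplicativeReductionAt
        ((W.hasMultiplicativeReductionAtPrime_iff_hasMultiplicativeReductionAt_ringOfIntegers v).mp h)
    exact key ⟨q, hq⟩ hv
  exact factorization_serreLevel_baseChange_three_eq_one_of_dvd_localTamagawaNumber W hρ j hj q hq2 hq3 hng hnm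
    (hc ▸ dvd_rfl)

end Summit.BirchSwinnertonDyer.BirchSwinnertonDyer.Theorems.ShadowSeedSerreLevel

end
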